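import Literature.NumberTheory.LFunctions.Zhang2022.Section3PhiFlat
import HarnessLib

/-!
# Zhang (2022) §3, the printed Lemma 3.2: `∑ ν(n)²τ₂(n)² n^{-s} = ζ(s)⁸ L(s,χ)⁸ φ*(s)` with `φ*`
# holomorphic and bounded on `re s > 1/2`

Topic `Literature/NumberTheory/LFunctions/Zhang2022` (Landau–Siegel autopsy tree; verdict-neutral
inventory). Y. Zhang, *Discrete mean estimates and the Landau–Siegel zero*, arXiv:2211.02515v1
(2022) — **an unrefereed manuscript, a claimed result under adjudication** (audit + repair census of
arXiv:2211.02515; no claim about Landau–Siegel is made here) — §3, Lemma 3.2 (p. 7 of the source):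
"Assume (A) holds. Then `∑_{D⁴<n≤D⁸} ν(n)²τ₂(n)²/n ≪ 𝓛^{-2007}`", whose one-paragraph sketch opens
with the sentence reproduced here: "It can be verified that the function
`φ*(s) = ζ(s)^{-8}L(s,χ)^{-8} ∑ₙ ν(n)²τ₂(n)²/nˢ` is analytic for `σ > 1/2` and it satisfies
`φ*(s) ≪ ∏_{p∣D} |1 − p^{-4s}|` for `σ ≥ σ₁ > 1/2`, where the implied constant depends on `σ₁`"
[p. 7, l. 83–96]. (`ν = 1 ∗ χ`, `τ₂ = d`; `χ` the real primitive character mod `D`.) This is the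
EIGHT-`L`-factor generating function whose contour shift past `re s = 1/2 + 0` is the manuscript's
unique consumer of a subconvex `L`-bound (autopsy rows `T-ALT1b/c`, module `Section3SubconvexInput`,
`k = 8`); the cell's input-free four-factor variant `ν²τ₂ ↔ ζ⁴L⁴φ♭` is `Section3PhiFlat.lean`, on
which this file is modelled line by line.

The LOCAL factors of `φ*` were computed in `Section3EulerFactors.lean`
(`hasSum_nu_sq_tau_sq_split|inert|ramified`: `φ*ₚ(z) = (1+11z+11z²+z³)(1−z)¹¹`,
`(1+6z²+z⁴)(1−z²)⁵`, `(1+z)(1−z)⁵ = (1−z)⁴(1−z²)` for `χ(p) = 1, −1, 0`, `z = p^{-s}`;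
`‖φ*ₚ − 1‖ ≤ 7659‖z‖²`, resp. `131‖z‖²`, off `D`). Everything below is PROVED (two definitions with
bodies: the local factor `starFactor w z` and `phiStar χ s = ∏' p, starFactor (χ p) (p^{-s})`; no
named fact):

* `LSeries_nu_sq_tau_sq_eq` — for `χ` mod `D ≥ 1` with `χ² = 1` and `re s > 1`:
  **`∑_{n≥1} ν(n)² d(n)² n^{-s} = ζ(s)⁸ · L(s,χ)⁸ · φ*(s)`** (Euler products: Mathlib's
  `EulerProduct.eulerProduct_hasProd` for the multiplicative `n ↦ ν(n)²d(n)²n^{-s}`,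
  `riemannZeta_eulerProduct_hasProd`, `DirichletCharacter.LSeries_eulerProduct_hasProd`) — the
  printed definition of `φ*` read as an identity;
* `hasProd_starFactor` — for `re s > 1/2` the product converges (unconditionally) to `φ*(s)`;
* `differentiableOn_phiStar` — **`φ*` is holomorphic on `re s > 1/2`** ("analytic for `σ > 1/2`";
  Weierstrass `M`-test: Mathlib's `Summable.hasProdLocallyUniformlyOn_one_add` +
  `TendstoLocallyUniformlyOn.differentiableOn` on each half-plane `re s > σ₀ > 1/2`, with
  `M_p = (7659 + 19D^{σ₀}) p^{-2σ₀}`);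
* `norm_phiStar_le` — for `1/2 < σ₀ ≤ re s`: `‖φ*(s)‖ ≤ 64^{ω(D)} exp(7659 ∑_p p^{-2σ₀})`
  (ramified factors `‖(1+p^{-s})(1−p^{-s})⁵‖ ≤ 64`), i.e. "`φ* ≪_{σ₁} D^{o(1)}`"; and
  `norm_phiStar_le_of_re_cpow_nonneg` — if moreover `re p^{-s} ≥ 0` for every `p ∣ D` (e.g.
  `|im s| log p ≤ π/2`), then `‖φ*(s)‖ ≤ exp(7659 ∑_p p^{-2σ₀})`, an ABSOLUTE constant
  (`‖(1−z)⁴(1−z²)‖ ≤ (1+‖z‖²)³` when `re z ≥ 0`) — the form relevant on the residue circle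
  `|s − 1| = α* = 𝓛^{-2024}` of the printed count.

On the printed majorant: the ramified local factor is `(1−p^{-s})⁴(1−p^{-2s})`, not `1 − p^{-4s}`
(`Section3EulerFactors.phiStar_ramified_eq`); both are bounded by an absolute constant per prime
divisor of `D`, so the printed "`≪ ∏_{p∣D}|1−p^{-4s}|`" and the bound `64^{ω(D)}` here play the same
role (`D^{o(1)}` on `σ ≥ σ₁ > 1/2`) — an immaterial slip of the sketch, recorded by the autopsy, not
repaired. What is NOT in this file: the contour shift of Lemma 3.2 (it needs `L(s,χ) ≪ D^{μ+ε}` on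
`re s = 1/2` with `16μ < 4`, a subconvex input the manuscript does not cite — autopsy row `T-ALT1b`)
and the residue count `𝓛^{-2007}`. No statement about the manuscript's Theorems 1–2 is made or
implied.

## References

* Y. Zhang, arXiv:2211.02515 (2022), §3, Lemma 3.2. [cite: Zhang2022LandauSiegel, §3, Lemma 3.2]
* E. C. Titchmarsh, *The Theory of the Riemann Zeta-Function*, 2nd ed. (1986), §1.1 (Euler
  products; the Weierstrass argument). [cite: Titchmarsh1986, §1.1]
-/

noncomputable section

open Complex Finset Filter Topology Set Real
open scoped LSeries.notation

namespace Literature.NumberTheory.LFunctions.Zhang2022.PhiStar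

open Literature.NumberTheory.LFunctions.Zhang2022.Section3EulerFactors
  (hasSum_nu_sq_tau_sq_split hasSum_nu_sq_tau_sq_inert hasSum_nu_sq_tau_sq_ramified
   phiStar_ramified_eq norm_phiStar_split_sub_one_le norm_phiStar_inert_sub_one_le
   norm_sum_fin_mul_pow_le summable_primes_norm_cpow_neg_sq norm_prime_cpow_neg_lt_one)
open Literature.NumberTheory.LFunctions.Zhang2022.PhiFlat
  (apply_eq_zero_or_one_or_neg_one apply_prime_eq_zero_iff summable_primes_rpow card_filter_dvd_le
   re_natCast_cpow_neg_nonneg)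

/-! ### The local factor `φ*ₚ` -/

/-- The local factor `φ*ₚ(z)` (`starFactor`) as a function of the splitting type
`w = χ(p) ∈ {1, −1, 0}` and `z = p^{-s}`: `(1+11z+11z²+z³)(1−z)¹¹` (split), `(1+6z²+z⁴)(1−z²)⁵`
(inert), `(1+z)(1−z)⁵` (ramified). [folklore] -/
def starFactor (w z : ℂ) : ℂ :=
  if w = 1 then (1 + 11 * z + 11 * z ^ 2 + z ^ 3) * (1 - z) ^ 11
  else if w = -1 then (1 + 6 * z ^ 2 + z ^ 4) * (1 - z ^ 2) ^ 5 else (1 + z) * (1 - z) ^ 5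

/-- Split value. [folklore] -/
theorem starFactor_one (z : ℂ) :
    starFactor 1 z = (1 + 11 * z + 11 * z ^ 2 + z ^ 3) * (1 - z) ^ 11 := by
  simp [starFactor]

/-- Inert value. [folklore] -/
theorem starFactor_neg_one (z : ℂ) :
    starFactor (-1) z = (1 + 6 * z ^ 2 + z ^ 4) * (1 - z ^ 2) ^ 5 := by
  have h : (-1 : ℂ) ≠ 1 := by norm_num
  simp [starFactor, h]

/-- Ramified value. [folklore] -/
theorem starFactor_zero (z : ℂ) : starFactor 0 z = (1 + z) * (1 - z) ^ 5 := by
  simp [starFactor]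

/-- Ramified value in the second shape: `φ*ₚ = (1−z)⁴(1−z²)` (the printed sketch has `1 − z⁴`
here). [cite: Zhang2022LandauSiegel, §3, Lemma 3.2 sketch] -/
theorem starFactor_zero_eq (z : ℂ) : starFactor 0 z = (1 - z) ^ 4 * (1 - z ^ 2) := by
  rw [starFactor_zero, phiStar_ramified_eq]

/-- **The local identity**: for `w ∈ {0, 1, −1}` and `‖z‖ < 1`,
`∑_m ν(pᵐ)²τ₂(pᵐ)² zᵐ = (1−z)^{−8}(1−wz)^{−8} · φ*ₚ(z)` with `ν(pᵐ) = 1 + w + ⋯ + wᵐ`,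
`τ₂(pᵐ) = m + 1` (`Section3EulerFactors.hasSum_nu_sq_tau_sq_*`). [folklore] -/
theorem hasSum_local {w z : ℂ} (hw : w = 0 ∨ w = 1 ∨ w = -1) (hz : ‖z‖ < 1) :
    HasSum (fun m : ℕ => geomPartialSum w m ^ 2 * ((m : ℂ) + 1) ^ 2 * z ^ m)
      (((1 - z)⁻¹) ^ 8 * ((1 - w * z)⁻¹) ^ 8 * starFactor w z) := by
  have hz1 : (1 : ℂ) - z ≠ 0 := by
    intro h; have : ‖z‖ = 1 := by rw [← sub_eq_zero.1 h, norm_one]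
    linarith
  have hz2 : (1 : ℂ) + z ≠ 0 := by
    intro h
    have : z = -1 := by linear_combination h
    rw [this, norm_neg, norm_one] at hz; exact lt_irrefl _ hz
  rcases hw with rfl | rfl | rfl
  · have h := hasSum_nu_sq_tau_sq_ramified hz
    rw [starFactor_zero]
    convert h using 1
    rw [zero_mul, sub_zero, inv_one, one_pow, mul_one]
    field_simp
  · have h := hasSum_nu_sq_tau_sq_split hz
    rw [starFactor_one]
    convert h using 1
    rw [one_mul]
    field_simp
  · have h := hasSum_nu_sq_tau_sq_inert hz
    rw [starFactor_neg_one]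
    convert h using 1
    rw [neg_one_mul, sub_neg_eq_add]
    field_simp

/-- `‖φ*ₚ(z) − 1‖ ≤ 7659‖z‖²` for `w = ±1` and `‖z‖ ≤ 1` (`7659` split, `131 ≤ 7659` inert).
[folklore] -/
theorem norm_starFactor_sub_one_le_of_unit {w z : ℂ} (hw : w = 1 ∨ w = -1) (hz : ‖z‖ ≤ 1) :
    ‖starFactor w z - 1‖ ≤ 7659 * ‖z‖ ^ 2 := by
  rcases hw with rfl | rfl
  · rw [starFactor_one]; exact norm_phiStar_split_sub_one_le hz
  · rw [starFactor_neg_one]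
    exact (norm_phiStar_inert_sub_one_le hz).trans (by gcongr; norm_num)

/-- The ramified factor expanded: `(1+z)(1−z)⁵ = 1 + z(−4 + 5z − 5z³ + 4z⁴ − z⁵)`. [folklore] -/
theorem starFactor_zero_expand (z : ℂ) :
    (1 + z) * (1 - z) ^ 5 = 1 + z * (-4 + 5 * z - 5 * z ^ 3 + 4 * z ^ 4 - z ^ 5) := by
  ring

/-- `‖φ*ₚ(z) − 1‖ ≤ 19‖z‖` for the ramified starFactor, `‖z‖ ≤ 1` (`19 = 4 + 5 + 5 + 4 + 1`).
[folklore] -/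
theorem norm_starFactor_zero_sub_one_le {z : ℂ} (hz : ‖z‖ ≤ 1) :
    ‖starFactor 0 z - 1‖ ≤ 19 * ‖z‖ := by
  have hc : (-4 + 5 * z - 5 * z ^ 3 + 4 * z ^ 4 - z ^ 5 : ℂ) =
      ∑ i : Fin 6, (![-4, 5, 0, -5, 4, -1] : Fin 6 → ℂ) i * z ^ (i : ℕ) := by
    simp [Fin.sum_univ_succ]
    ring
  have hn : ∑ i : Fin 6, ‖(![-4, 5, 0, -5, 4, -1] : Fin 6 → ℂ) i‖ = 19 := by
    simp [Fin.sum_univ_succ]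
    norm_num
  have hB : ‖(-4 + 5 * z - 5 * z ^ 3 + 4 * z ^ 4 - z ^ 5 : ℂ)‖ ≤ 19 := by
    rw [hc, ← hn]
    exact norm_sum_fin_mul_pow_le hz _
  rw [starFactor_zero, starFactor_zero_expand, add_sub_cancel_left, norm_mul, mul_comm]
  exact mul_le_mul_of_nonneg_right hB (norm_nonneg _)

/-- `‖φ*ₚ(z)‖ ≤ 64` for the ramified factor, `‖z‖ ≤ 1` (`‖1+z‖ ≤ 2`, `‖1−z‖⁵ ≤ 32`).
[folklore] -/
theorem norm_starFactor_zero_le {z : ℂ} (hz : ‖z‖ ≤ 1) : ‖starFactor 0 z‖ ≤ 64 := by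
  rw [starFactor_zero, norm_mul, norm_pow]
  have h1 : ‖(1 : ℂ) + z‖ ≤ 2 := by
    have h := norm_add_le (1 : ℂ) z; rw [norm_one] at h; linarith
  have h2 : ‖(1 : ℂ) - z‖ ≤ 2 := by
    have h := norm_sub_le (1 : ℂ) z; rw [norm_one] at h; linarith
  have h3 : ‖(1 : ℂ) - z‖ ^ 5 ≤ 2 ^ 5 := pow_le_pow_left₀ (norm_nonneg _) h2 5
  calc ‖(1 : ℂ) + z‖ * ‖(1 : ℂ) - z‖ ^ 5 ≤ 2 * 2 ^ 5 :=
        mul_le_mul h1 h3 (pow_nonneg (norm_nonneg _) 5) (by norm_num)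
    _ = 64 := by norm_num

/-- `‖1 − z‖² ≤ 1 + ‖z‖²` when `re z ≥ 0`: `‖1 − z‖² = 1 − 2 re z + ‖z‖²`. [folklore] -/
theorem norm_one_sub_sq_le_of_re_nonneg {z : ℂ} (hz : 0 ≤ z.re) :
    ‖(1 : ℂ) - z‖ ^ 2 ≤ 1 + ‖z‖ ^ 2 := by
  rw [Complex.sq_norm, Complex.sq_norm, Complex.normSq_apply, Complex.normSq_apply]
  simp only [sub_re, one_re, sub_im, one_im, zero_sub, mul_neg, neg_mul, neg_neg]
  nlinarith

/-- `‖φ*ₚ(z)‖ ≤ (1 + ‖z‖²)³` for the ramified starFactor when `re z ≥ 0`: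
`φ*ₚ = (1−z)⁴(1−z²)` with `‖1−z‖² ≤ 1 + ‖z‖²` and `‖1 − z²‖ ≤ 1 + ‖z‖²`. [folklore] -/
theorem norm_starFactor_zero_le_of_re_nonneg {z : ℂ} (hz : 0 ≤ z.re) :
    ‖starFactor 0 z‖ ≤ (1 + ‖z‖ ^ 2) ^ 3 := by
  rw [starFactor_zero_eq, norm_mul, norm_pow]
  have h1 : ‖(1 : ℂ) - z‖ ^ 4 ≤ (1 + ‖z‖ ^ 2) ^ 2 := by
    rw [show ‖(1 : ℂ) - z‖ ^ 4 = (‖(1 : ℂ) - z‖ ^ 2) ^ 2 by ring]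
    exact pow_le_pow_left₀ (sq_nonneg _) (norm_one_sub_sq_le_of_re_nonneg hz) 2
  have h2 : ‖(1 : ℂ) - z ^ 2‖ ≤ 1 + ‖z‖ ^ 2 := by
    have h := norm_sub_le (1 : ℂ) (z ^ 2); rw [norm_one, norm_pow] at h; exact h
  calc ‖(1 : ℂ) - z‖ ^ 4 * ‖(1 : ℂ) - z ^ 2‖ ≤ (1 + ‖z‖ ^ 2) ^ 2 * (1 + ‖z‖ ^ 2) :=
        mul_le_mul h1 h2 (norm_nonneg _) (by positivity)
    _ = (1 + ‖z‖ ^ 2) ^ 3 := by ring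

/-- `z ↦ φ*ₚ(z)` is a polynomial, hence entire (for each fixed `w`). [folklore] -/
theorem differentiable_starFactor (w : ℂ) : Differentiable ℂ (starFactor w) := by
  unfold starFactor
  split_ifs <;> fun_prop

/-! ### The Dirichlet series of `ν²τ₂²` and its Euler product -/

section Series

variable {D : ℕ} (χ : DirichletCharacter ℂ D)

/-- The general term `ν(n)² d(n)² n^{-s}` (`starTerm`). [folklore] -/
def starTerm (s : ℂ) (n : ℕ) : ℂ :=
  divisorSumChar χ n ^ 2 * (n.divisors.card : ℂ) ^ 2 * (n : ℂ) ^ (-s)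

/-- The `L`-series of `ν²d²` is `∑' starTerm`. [folklore] -/
theorem LSeries_eq_tsum (s : ℂ) :
    L (fun n => divisorSumChar χ n ^ 2 * (n.divisors.card : ℂ) ^ 2) s = ∑' n, starTerm χ s n := by
  rw [LSeries]
  refine tsum_congr fun n => ?_
  rw [LSeries.term_def₀ (by simp), starTerm]

/-- `starTerm` is multiplicative on coprime arguments. [folklore] -/
theorem starTerm_mul_of_coprime (s : ℂ) {m n : ℕ} (hmn : m.Coprime n) :
    starTerm χ s (m * n) = starTerm χ s m * starTerm χ s n := by
  simp only [starTerm]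
  rw [divisorSumChar_mul_of_coprime χ hmn, Nat.Coprime.card_divisors_mul hmn, Nat.cast_mul,
    Nat.cast_mul, natCast_mul_natCast_cpow]
  ring

/-- `starTerm 1 = 1`. [folklore] -/
theorem starTerm_one (s : ℂ) : starTerm χ s 1 = 1 := by simp [starTerm]

/-- `starTerm 0 = 0`. [folklore] -/
theorem starTerm_zero (s : ℂ) : starTerm χ s 0 = 0 := by simp [starTerm]

/-- On prime powers: `starTerm (pᵉ) = ν(pᵉ)² (e+1)² (p^{-s})ᵉ`. [folklore] -/
theorem starTerm_prime_pow (s : ℂ) {p : ℕ} (hp : p.Prime) (e : ℕ) :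
    starTerm χ s (p ^ e) = geomPartialSum (χ (p : ZMod D)) e ^ 2 * ((e : ℂ) + 1) ^ 2 *
      (((p : ℕ) : ℂ) ^ (-s)) ^ e := by
  rw [starTerm, divisorSumChar_prime_pow χ hp, ← ArithmeticFunction.sigma_zero_apply,
    ArithmeticFunction.sigma_zero_apply_prime_pow hp, Nat.cast_pow, ← natCast_cpow_natCast_mul,
    cpow_nat_mul]
  push_cast
  ring

/-- Absolute convergence for `re s > 1` (`|ν(n)²d(n)²| ≤ d(n)⁴ ≤ C⁴ n^{4η}`, `η = (σ−1)/8`).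
[folklore] -/
theorem summable_norm_starTerm {s : ℂ} (hs : 1 < s.re) : Summable fun n => ‖starTerm χ s n‖ := by
  obtain ⟨C, hC1, hC⟩ :=
    Literature.NumberTheory.Sieve.exists_card_divisors_le_mul_rpow' (ε := (s.re - 1) / 8)
      (by linarith)
  have hsum : Summable fun n : ℕ => C ^ 4 * (n : ℝ) ^ (-(s.re + 1) / 2) := by
    refine (Real.summable_nat_rpow.2 ?_).mul_left _
    linarith
  refine Summable.of_nonneg_of_le (fun n => norm_nonneg _) (fun n => ?_) hsum
  rcases Nat.eq_zero_or_pos n with rfl | hn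
  · rw [starTerm_zero, norm_zero]; positivity
  · have hn' : (0 : ℝ) < n := by exact_mod_cast hn
    rw [starTerm, norm_mul, norm_mul, norm_pow, norm_pow, norm_natCast_cpow_of_pos hn, neg_re,
      Complex.norm_natCast]
    have hν : ‖divisorSumChar χ n‖ ≤ C * (n : ℝ) ^ ((s.re - 1) / 8) :=
      (norm_divisorSumChar_le χ n).trans (hC n)
    have hτ : (n.divisors.card : ℝ) ≤ C * (n : ℝ) ^ ((s.re - 1) / 8) := hC n
    have h0 : 0 ≤ ‖divisorSumChar χ n‖ := norm_nonneg _
    have h0' : (0 : ℝ) ≤ (n.divisors.card : ℝ) := by positivity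
    calc ‖divisorSumChar χ n‖ ^ 2 * (n.divisors.card : ℝ) ^ 2 * (n : ℝ) ^ (-s.re)
        ≤ (C * (n : ℝ) ^ ((s.re - 1) / 8)) ^ 2 * (C * (n : ℝ) ^ ((s.re - 1) / 8)) ^ 2 *
            (n : ℝ) ^ (-s.re) := by gcongr
      _ = C ^ 4 * ((n : ℝ) ^ ((s.re - 1) / 8) * (n : ℝ) ^ ((s.re - 1) / 8) *
            ((n : ℝ) ^ ((s.re - 1) / 8) * (n : ℝ) ^ ((s.re - 1) / 8)) * (n : ℝ) ^ (-s.re)) := by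
          ring
      _ = C ^ 4 * (n : ℝ) ^ (-(s.re + 1) / 2) := by
          rw [← Real.rpow_add hn', ← Real.rpow_add hn', ← Real.rpow_add hn']
          ring_nf

/-- **Euler product for `∑ ν(n)²d(n)² n^{-s}`** (`re s > 1`). [folklore] -/
theorem hasProd_starTerm {s : ℂ} (hs : 1 < s.re) :
    HasProd (fun p : Nat.Primes => ∑' e, starTerm χ s ((p : ℕ) ^ e)) (∑' n, starTerm χ s n) :=
  EulerProduct.eulerProduct_hasProd (f := starTerm χ s) (starTerm_one χ s)
    (fun hmn => starTerm_mul_of_coprime χ s hmn) (summable_norm_starTerm χ hs) (starTerm_zero χ s)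

/-- The local Euler factor in closed form (`χ² = 1`, `re s > 0`):
`∑_e starTerm (pᵉ) = (1 − p^{-s})^{-8} (1 − χ(p)p^{-s})^{-8} φ*ₚ(p^{-s})`. [folklore] -/
theorem tsum_starTerm_prime_pow (hχ : χ ^ 2 = 1) {s : ℂ} (hs : 0 < s.re) (p : Nat.Primes) :
    ∑' e, starTerm χ s ((p : ℕ) ^ e) =
      ((1 - ((p : ℕ) : ℂ) ^ (-s))⁻¹) ^ 8 *
        ((1 - χ ((p : ℕ) : ZMod D) * ((p : ℕ) : ℂ) ^ (-s))⁻¹) ^ 8 *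
        starFactor (χ ((p : ℕ) : ZMod D)) (((p : ℕ) : ℂ) ^ (-s)) := by
  have hz := norm_prime_cpow_neg_lt_one hs p
  have hw := apply_eq_zero_or_one_or_neg_one χ hχ ((p : ℕ) : ZMod D)
  have h := hasSum_local hw hz
  rw [← h.tsum_eq]
  exact tsum_congr fun e => starTerm_prime_pow χ s p.prop e

end Series

/-! ### `φ*` as a function; convergence for `re s > 1/2` -/

section PhiStarDef

variable {D : ℕ} (χ : DirichletCharacter ℂ D)

/-- **`φ*(s) = ∏_p φ*ₚ(p^{-s})`** (an unconditionally convergent product for `re s > 1/2`).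
[cite: Zhang2022LandauSiegel, §3, Lemma 3.2 sketch] -/
def phiStar (s : ℂ) : ℂ :=
  ∏' p : Nat.Primes, starFactor (χ ((p : ℕ) : ZMod D)) (((p : ℕ) : ℂ) ^ (-s))

/-- The uniform majorant: for `σ₀ ≤ re s` (`σ₀ > 0`),
`‖φ*ₚ(p^{-s}) − 1‖ ≤ (7659 + 19 D^{σ₀}) p^{-2σ₀}` (`χ² = 1`, `D ≥ 1`; for `p ∣ D` the bound
`19p^{-σ} ≤ 19 D^{σ₀} p^{-2σ₀}` is used). [folklore] -/
theorem norm_starFactor_sub_one_le [NeZero D] (hχ : χ ^ 2 = 1) {σ₀ : ℝ} (hσ₀ : 0 < σ₀) {s : ℂ}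
    (hs : σ₀ ≤ s.re) (p : Nat.Primes) :
    ‖starFactor (χ ((p : ℕ) : ZMod D)) (((p : ℕ) : ℂ) ^ (-s)) - 1‖ ≤
      (7659 + 19 * (D : ℝ) ^ σ₀) * ((p : ℕ) : ℝ) ^ (-(2 * σ₀)) := by
  have hp0 : (0 : ℝ) < (p : ℕ) := by exact_mod_cast p.prop.pos
  have hp1 : (1 : ℝ) ≤ (p : ℕ) := by exact_mod_cast p.prop.one_lt.le
  have hz : ‖((p : ℕ) : ℂ) ^ (-s)‖ = ((p : ℕ) : ℝ) ^ (-s.re) := by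
    rw [norm_natCast_cpow_of_pos p.prop.pos, neg_re]
  have hz1 : ‖((p : ℕ) : ℂ) ^ (-s)‖ ≤ 1 := (norm_prime_cpow_neg_lt_one (by linarith) p).le
  have hzσ : ‖((p : ℕ) : ℂ) ^ (-s)‖ ≤ ((p : ℕ) : ℝ) ^ (-σ₀) := by
    rw [hz]; exact Real.rpow_le_rpow_of_exponent_le hp1 (by linarith)
  have hsq : ‖((p : ℕ) : ℂ) ^ (-s)‖ ^ 2 ≤ ((p : ℕ) : ℝ) ^ (-(2 * σ₀)) := by
    calc ‖((p : ℕ) : ℂ) ^ (-s)‖ ^ 2 ≤ (((p : ℕ) : ℝ) ^ (-σ₀)) ^ 2 :=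
          pow_le_pow_left₀ (norm_nonneg _) hzσ 2
      _ = ((p : ℕ) : ℝ) ^ (-(2 * σ₀)) := by
          rw [← Real.rpow_natCast, ← Real.rpow_mul hp0.le]; ring_nf
  have hDσ : 0 ≤ (D : ℝ) ^ σ₀ := by positivity
  have hpow0 : 0 ≤ ((p : ℕ) : ℝ) ^ (-(2 * σ₀)) := by positivity
  rcases apply_eq_zero_or_one_or_neg_one χ hχ ((p : ℕ) : ZMod D) with h0 | h1
  · -- ramified: `p ∣ D`, so `p ≤ D` and `p^{-σ₀} = p^{σ₀} p^{-2σ₀} ≤ D^{σ₀} p^{-2σ₀}`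
    have hpD : (p : ℕ) ∣ D := (apply_prime_eq_zero_iff χ p.prop).1 h0
    have hpD' : ((p : ℕ) : ℝ) ≤ D := by
      exact_mod_cast Nat.le_of_dvd (Nat.pos_of_ne_zero (NeZero.ne D)) hpD
    rw [h0]
    refine (norm_starFactor_zero_sub_one_le hz1).trans ?_
    have h1 : ((p : ℕ) : ℝ) ^ (-σ₀) = ((p : ℕ) : ℝ) ^ σ₀ * ((p : ℕ) : ℝ) ^ (-(2 * σ₀)) := by
      rw [← Real.rpow_add hp0]; ring_nf
    have h2 : ((p : ℕ) : ℝ) ^ σ₀ ≤ (D : ℝ) ^ σ₀ := Real.rpow_le_rpow hp0.le hpD' hσ₀.le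
    calc 19 * ‖((p : ℕ) : ℂ) ^ (-s)‖ ≤ 19 * ((p : ℕ) : ℝ) ^ (-σ₀) := by linarith
      _ = 19 * (((p : ℕ) : ℝ) ^ σ₀ * ((p : ℕ) : ℝ) ^ (-(2 * σ₀))) := by rw [h1]
      _ ≤ 19 * ((D : ℝ) ^ σ₀ * ((p : ℕ) : ℝ) ^ (-(2 * σ₀))) := by gcongr
      _ ≤ (7659 + 19 * (D : ℝ) ^ σ₀) * ((p : ℕ) : ℝ) ^ (-(2 * σ₀)) := by nlinarith
  · refine (norm_starFactor_sub_one_le_of_unit h1 hz1).trans ?_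
    calc 7659 * ‖((p : ℕ) : ℂ) ^ (-s)‖ ^ 2 ≤ 7659 * ((p : ℕ) : ℝ) ^ (-(2 * σ₀)) := by gcongr
      _ ≤ (7659 + 19 * (D : ℝ) ^ σ₀) * ((p : ℕ) : ℝ) ^ (-(2 * σ₀)) := by nlinarith

/-- `∑_p ‖φ*ₚ(p^{-s}) − 1‖ < ∞` for `re s > 1/2` (`χ² = 1`, `D ≥ 1`). [folklore] -/
theorem summable_norm_starFactor_sub_one [NeZero D] (hχ : χ ^ 2 = 1) {s : ℂ} (hs : 1 / 2 < s.re) :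
    Summable fun p : Nat.Primes => ‖starFactor (χ ((p : ℕ) : ZMod D)) (((p : ℕ) : ℂ) ^ (-s)) - 1‖ :=
  Summable.of_nonneg_of_le (fun p => norm_nonneg _)
    (fun p => norm_starFactor_sub_one_le χ hχ (σ₀ := s.re) (by linarith) le_rfl p)
    ((summable_primes_rpow hs).mul_left _)

/-- **Convergence**: for `re s > 1/2`, `∏_p φ*ₚ(p^{-s})` converges to `φ*(s)` — the convergence
half of "φ* is analytic for σ > 1/2". [cite: Zhang2022LandauSiegel, §3, Lemma 3.2 sketch] -/
theorem hasProd_starFactor [NeZero D] (hχ : χ ^ 2 = 1) {s : ℂ} (hs : 1 / 2 < s.re) :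
    HasProd (fun p : Nat.Primes => starFactor (χ ((p : ℕ) : ZMod D)) (((p : ℕ) : ℂ) ^ (-s)))
      (phiStar χ s) := by
  have hsum : Summable fun p : Nat.Primes =>
      starFactor (χ ((p : ℕ) : ZMod D)) (((p : ℕ) : ℂ) ^ (-s)) - 1 :=
    Summable.of_norm (summable_norm_starFactor_sub_one χ hχ hs)
  have hm : Multipliable fun p : Nat.Primes =>
      1 + (starFactor (χ ((p : ℕ) : ZMod D)) (((p : ℕ) : ℂ) ^ (-s)) - 1) :=
    Complex.multipliable_one_add_of_summable hsum
  have hm' : Multipliable fun p : Nat.Primes =>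
      starFactor (χ ((p : ℕ) : ZMod D)) (((p : ℕ) : ℂ) ^ (-s)) :=
    hm.congr fun p => by ring
  exact hm'.hasProd

/-- **The global identity** (`χ² = 1`, `D ≥ 1`, `re s > 1`):
`∑_{n ≥ 1} ν(n)² d(n)² n^{-s} = ζ(s)⁸ · L(s, χ)⁸ · φ*(s)` — the printed definition
`φ*(s) = ζ(s)^{-8}L(s,χ)^{-8}∑ₙ ν(n)²τ₂(n)²n^{-s}` as an identity of absolutely convergent Euler
products. [cite: Zhang2022LandauSiegel, §3, Lemma 3.2 sketch] -/
theorem LSeries_nu_sq_tau_sq_eq [NeZero D] (hχ : χ ^ 2 = 1) {s : ℂ} (hs : 1 < s.re) :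
    L (fun n => divisorSumChar χ n ^ 2 * (n.divisors.card : ℂ) ^ 2) s =
      riemannZeta s ^ 8 * (L ↗χ s) ^ 8 * phiStar χ s := by
  have hζ := riemannZeta_eulerProduct_hasProd hs
  have hL := DirichletCharacter.LSeries_eulerProduct_hasProd χ hs
  have hφ := hasProd_starFactor χ hχ (s := s) (by linarith)
  have hν := hasProd_starTerm χ hs
  have rhs := ((hζ.pow 8).mul (hL.pow 8)).mul hφ
  have hν' : HasProd (fun p : Nat.Primes =>
      ((1 - ((p : ℕ) : ℂ) ^ (-s))⁻¹) ^ 8 *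
        ((1 - χ ((p : ℕ) : ZMod D) * ((p : ℕ) : ℂ) ^ (-s))⁻¹) ^ 8 *
        starFactor (χ ((p : ℕ) : ZMod D)) (((p : ℕ) : ℂ) ^ (-s))) (∑' n, starTerm χ s n) :=
    hν.congr_fun fun p => (tsum_starTerm_prime_pow χ hχ (by linarith) p).symm
  rw [LSeries_eq_tsum]
  exact hν'.unique rhs

end PhiStarDef

/-! ### Holomorphy on `re s > 1/2` (Weierstrass `M`-test) -/

section Holomorphy

variable {D : ℕ} (χ : DirichletCharacter ℂ D)

/-- Each `s ↦ φ*ₚ(p^{-s})` is entire. [folklore] -/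
theorem differentiable_starFactor_cpow (w : ℂ) (p : Nat.Primes) :
    Differentiable ℂ fun s : ℂ => starFactor w (((p : ℕ) : ℂ) ^ (-s)) :=
  (differentiable_starFactor w).comp
    (differentiable_id.neg.const_cpow (Or.inl (by exact_mod_cast p.prop.ne_zero)))

/-- **`φ*` is holomorphic on `re s > σ₀`** for every `σ₀ > 1/2` (`χ² = 1`, `D ≥ 1`): Mathlib's
`Summable.hasProdLocallyUniformlyOn_one_add` with the majorant `(7659 + 19D^{σ₀}) p^{-2σ₀}` and
`TendstoLocallyUniformlyOn.differentiableOn`. [cite: Titchmarsh1986, §1.1] -/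
theorem differentiableOn_phiStar_of_lt [NeZero D] (hχ : χ ^ 2 = 1) {σ₀ : ℝ} (hσ₀ : 1 / 2 < σ₀) :
    DifferentiableOn ℂ (phiStar χ) {s : ℂ | σ₀ < s.re} := by
  set U : Set ℂ := {s : ℂ | σ₀ < s.re} with hU
  have hUo : IsOpen U := isOpen_lt continuous_const Complex.continuous_re
  set f : Nat.Primes → ℂ → ℂ := fun p s =>
    starFactor (χ ((p : ℕ) : ZMod D)) (((p : ℕ) : ℂ) ^ (-s)) - 1 with hf
  have hfd : ∀ p, Differentiable ℂ (f p) := fun p =>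
    (differentiable_starFactor_cpow (χ ((p : ℕ) : ZMod D)) p).sub_const 1
  have hu : Summable fun p : Nat.Primes =>
      (7659 + 19 * (D : ℝ) ^ σ₀) * ((p : ℕ) : ℝ) ^ (-(2 * σ₀)) :=
    (summable_primes_rpow hσ₀).mul_left _
  have hle : ∀ᶠ p in cofinite, ∀ s ∈ U,
      ‖f p s‖ ≤ (7659 + 19 * (D : ℝ) ^ σ₀) * ((p : ℕ) : ℝ) ^ (-(2 * σ₀)) :=
    Eventually.of_forall fun p s hs =>
      norm_starFactor_sub_one_le χ hχ (σ₀ := σ₀) (by linarith) (le_of_lt hs) p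
  have hprod :=
    hu.hasProdLocallyUniformlyOn_one_add hUo hle fun p => (hfd p).continuous.continuousOn
  have hdiff : DifferentiableOn ℂ (fun s => ∏' p : Nat.Primes, (1 + f p s)) U := by
    refine (hasProdLocallyUniformlyOn_iff_tendstoLocallyUniformlyOn.mp hprod).differentiableOn
      (Eventually.of_forall fun F => ?_) hUo
    exact (Differentiable.fun_finsetProd fun p _ => (hfd p).const_add 1).differentiableOn
  refine hdiff.congr fun s _ => ?_
  simp only [hf, add_sub_cancel, phiStar]

/-- **`φ*` is holomorphic on `re s > 1/2`** ("analytic for `σ > 1/2`").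
[cite: Zhang2022LandauSiegel, §3, Lemma 3.2 sketch] -/
theorem differentiableOn_phiStar [NeZero D] (hχ : χ ^ 2 = 1) :
    DifferentiableOn ℂ (phiStar χ) {s : ℂ | 1 / 2 < s.re} := by
  intro s hs
  have hs' : 1 / 2 < s.re := hs
  set σ₀ : ℝ := (1 / 2 + s.re) / 2 with hσ₀
  have h1 : 1 / 2 < σ₀ := by rw [hσ₀]; linarith
  have h2 : σ₀ < s.re := by rw [hσ₀]; linarith
  have hd := differentiableOn_phiStar_of_lt χ hχ h1
  have hopen : IsOpen {s : ℂ | σ₀ < s.re} := isOpen_lt continuous_const Complex.continuous_re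
  exact (hd.differentiableAt (hopen.mem_nhds h2)).differentiableWithinAt

end Holomorphy

/-! ### Bounds -/

section Bounds

variable {D : ℕ} (χ : DirichletCharacter ℂ D)

/-- `p^{-2 re s} ≤ p^{-2σ₀}` for `σ₀ ≤ re s`, in the form `‖p^{-s}‖² ≤ p^{-2σ₀}`. [folklore] -/
theorem norm_cpow_sq_le {σ₀ : ℝ} {s : ℂ} (hs : σ₀ ≤ s.re) (p : Nat.Primes) :
    ‖((p : ℕ) : ℂ) ^ (-s)‖ ^ 2 ≤ ((p : ℕ) : ℝ) ^ (-(2 * σ₀)) := by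
  have hp0 : (0 : ℝ) < (p : ℕ) := by exact_mod_cast p.prop.pos
  rw [norm_natCast_cpow_of_pos p.prop.pos, neg_re, ← Real.rpow_natCast, ← Real.rpow_mul hp0.le]
  exact Real.rpow_le_rpow_of_exponent_le (by exact_mod_cast p.prop.one_lt.le)
    (by push_cast; linarith)

/-- An unramified factor is at most `exp(7659 p^{-2σ₀})` in norm (`1/2 < σ₀ ≤ re s`,
`χ(p) = ±1`). [folklore] -/
theorem norm_starFactor_le_exp_of_unit {σ₀ : ℝ} (hσ₀ : 1 / 2 < σ₀) {s : ℂ} (hs : σ₀ ≤ s.re)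
    (p : Nat.Primes) {w : ℂ} (hw : w = 1 ∨ w = -1) :
    ‖starFactor w (((p : ℕ) : ℂ) ^ (-s))‖ ≤ Real.exp (7659 * ((p : ℕ) : ℝ) ^ (-(2 * σ₀))) := by
  have hz1 : ‖((p : ℕ) : ℂ) ^ (-s)‖ ≤ 1 := (norm_prime_cpow_neg_lt_one (by linarith) p).le
  have hdev := norm_starFactor_sub_one_le_of_unit hw hz1
  have hsq := norm_cpow_sq_le hs p
  calc ‖starFactor w (((p : ℕ) : ℂ) ^ (-s))‖
      ≤ ‖(1 : ℂ)‖ + ‖starFactor w (((p : ℕ) : ℂ) ^ (-s)) - 1‖ := by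
        have := norm_add_le (1 : ℂ) (starFactor w (((p : ℕ) : ℂ) ^ (-s)) - 1)
        rwa [add_sub_cancel] at this
    _ ≤ 1 + 7659 * ((p : ℕ) : ℝ) ^ (-(2 * σ₀)) := by rw [norm_one]; linarith
    _ ≤ Real.exp (7659 * ((p : ℕ) : ℝ) ^ (-(2 * σ₀))) := by
        linarith [Real.add_one_le_exp (7659 * ((p : ℕ) : ℝ) ^ (-(2 * σ₀)))]

/-- A finite partial product: for `1/2 < σ₀ ≤ re s`,
`‖∏_{p ∈ F} φ*ₚ(p^{-s})‖ ≤ 64^{ω(D)} exp(7659 ∑_p p^{-2σ₀})`. [folklore] -/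
theorem norm_prod_starFactor_le [NeZero D] (hχ : χ ^ 2 = 1) {σ₀ : ℝ} (hσ₀ : 1 / 2 < σ₀) {s : ℂ}
    (hs : σ₀ ≤ s.re) (F : Finset Nat.Primes) :
    ‖∏ p ∈ F, starFactor (χ ((p : ℕ) : ZMod D)) (((p : ℕ) : ℂ) ^ (-s))‖ ≤
      (64 : ℝ) ^ D.primeFactors.card *
        Real.exp (7659 * ∑' p : Nat.Primes, ((p : ℕ) : ℝ) ^ (-(2 * σ₀))) := by
  classical
  have hsumm := summable_primes_rpow hσ₀
  rw [norm_prod, ← Finset.prod_filter_mul_prod_filter_not F (fun p : Nat.Primes => (p : ℕ) ∣ D)]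
  -- ramified part
  have hram : ∏ p ∈ F.filter (fun p : Nat.Primes => (p : ℕ) ∣ D),
      ‖starFactor (χ ((p : ℕ) : ZMod D)) (((p : ℕ) : ℂ) ^ (-s))‖ ≤
        (64 : ℝ) ^ D.primeFactors.card := by
    calc ∏ p ∈ F.filter (fun p : Nat.Primes => (p : ℕ) ∣ D),
          ‖starFactor (χ ((p : ℕ) : ZMod D)) (((p : ℕ) : ℂ) ^ (-s))‖
        ≤ ∏ _p ∈ F.filter (fun p : Nat.Primes => (p : ℕ) ∣ D), (64 : ℝ) := by
          refine Finset.prod_le_prod (fun _ _ => norm_nonneg _) fun p hp => ?_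
          rw [Finset.mem_filter] at hp
          rw [(apply_prime_eq_zero_iff χ p.prop).2 hp.2]
          exact norm_starFactor_zero_le (norm_prime_cpow_neg_lt_one (by linarith) p).le
      _ = (64 : ℝ) ^ (F.filter fun p : Nat.Primes => (p : ℕ) ∣ D).card := by
          rw [Finset.prod_const]
      _ ≤ (64 : ℝ) ^ D.primeFactors.card :=
          pow_le_pow_right₀ (by norm_num) (card_filter_dvd_le F)
  -- unramified part
  have hunr : ∏ p ∈ F.filter (fun p : Nat.Primes => ¬ (p : ℕ) ∣ D),
      ‖starFactor (χ ((p : ℕ) : ZMod D)) (((p : ℕ) : ℂ) ^ (-s))‖ ≤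
      Real.exp (7659 * ∑' p : Nat.Primes, ((p : ℕ) : ℝ) ^ (-(2 * σ₀))) := by
    set G := F.filter (fun p : Nat.Primes => ¬ (p : ℕ) ∣ D) with hG
    have h1 : ∀ p ∈ G, ‖starFactor (χ ((p : ℕ) : ZMod D)) (((p : ℕ) : ℂ) ^ (-s))‖ ≤
        Real.exp (7659 * ((p : ℕ) : ℝ) ^ (-(2 * σ₀))) := by
      intro p hp
      rw [hG, Finset.mem_filter] at hp
      have hw : χ ((p : ℕ) : ZMod D) = 1 ∨ χ ((p : ℕ) : ZMod D) = -1 := by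
        rcases apply_eq_zero_or_one_or_neg_one χ hχ ((p : ℕ) : ZMod D) with h | h
        · exact absurd ((apply_prime_eq_zero_iff χ p.prop).1 h) hp.2
        · exact h
      exact norm_starFactor_le_exp_of_unit hσ₀ hs p hw
    calc ∏ p ∈ G, ‖starFactor (χ ((p : ℕ) : ZMod D)) (((p : ℕ) : ℂ) ^ (-s))‖
        ≤ ∏ p ∈ G, Real.exp (7659 * ((p : ℕ) : ℝ) ^ (-(2 * σ₀))) :=
          Finset.prod_le_prod (fun _ _ => norm_nonneg _) h1
      _ = Real.exp (∑ p ∈ G, 7659 * ((p : ℕ) : ℝ) ^ (-(2 * σ₀))) := by rw [Real.exp_sum]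
      _ ≤ Real.exp (7659 * ∑' p : Nat.Primes, ((p : ℕ) : ℝ) ^ (-(2 * σ₀))) := by
          rw [Real.exp_le_exp, ← Finset.mul_sum]
          gcongr
          exact hsumm.sum_le_tsum G fun p _ => by positivity
  have h0 : 0 ≤ ∏ p ∈ F.filter (fun p : Nat.Primes => ¬ (p : ℕ) ∣ D),
      ‖starFactor (χ ((p : ℕ) : ZMod D)) (((p : ℕ) : ℂ) ^ (-s))‖ :=
    Finset.prod_nonneg fun _ _ => norm_nonneg _
  exact mul_le_mul hram hunr h0 (by positivity)

/-- **`φ*` is bounded on `re s ≥ σ₀ > 1/2`**: `‖φ*(s)‖ ≤ 64^{ω(D)} exp(7659 ∑_p p^{-2σ₀})`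
(`χ² = 1`, `D ≥ 1`) — the printed "`φ*(s) ≪ ∏_{p∣D}(…)` for `σ ≥ σ₁ > 1/2`, the implied constant
depending on `σ₁`", with the ramified factors bounded by `64` each.
[cite: Zhang2022LandauSiegel, §3, Lemma 3.2 sketch] -/
theorem norm_phiStar_le [NeZero D] (hχ : χ ^ 2 = 1) {σ₀ : ℝ} (hσ₀ : 1 / 2 < σ₀) {s : ℂ}
    (hs : σ₀ ≤ s.re) :
    ‖phiStar χ s‖ ≤ (64 : ℝ) ^ D.primeFactors.card *
      Real.exp (7659 * ∑' p : Nat.Primes, ((p : ℕ) : ℝ) ^ (-(2 * σ₀))) := by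
  have hP := hasProd_starFactor χ hχ (s := s) (by linarith)
  have ht : Tendsto (fun F : Finset Nat.Primes =>
      ∏ p ∈ F, starFactor (χ ((p : ℕ) : ZMod D)) (((p : ℕ) : ℂ) ^ (-s))) atTop
      (𝓝 (phiStar χ s)) := by
    simpa [HasProd] using hP
  exact le_of_tendsto' ht.norm fun F => norm_prod_starFactor_le χ hχ hσ₀ hs F

/-- **`φ*` near the real axis is absolutely bounded**: if `1/2 < σ₀ ≤ re s` and `re p^{-s} ≥ 0`
for every prime `p ∣ D` (e.g. `|im s| log D ≤ π/2`, `PhiFlat.re_natCast_cpow_neg_nonneg`), then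
`‖φ*(s)‖ ≤ exp(7659 ∑_p p^{-2σ₀})` — no dependence on `D` (ramified factors
`‖(1−p^{-s})⁴(1−p^{-2s})‖ ≤ (1 + p^{-2σ})³ ≤ exp(3p^{-2σ₀})`). [folklore] -/
theorem norm_phiStar_le_of_re_cpow_nonneg [NeZero D] (hχ : χ ^ 2 = 1) {σ₀ : ℝ} (hσ₀ : 1 / 2 < σ₀)
    {s : ℂ} (hs : σ₀ ≤ s.re)
    (hre : ∀ p : ℕ, p.Prime → p ∣ D → 0 ≤ (((p : ℕ) : ℂ) ^ (-s)).re) :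
    ‖phiStar χ s‖ ≤ Real.exp (7659 * ∑' p : Nat.Primes, ((p : ℕ) : ℝ) ^ (-(2 * σ₀))) := by
  have hsumm := summable_primes_rpow hσ₀
  have hP := hasProd_starFactor χ hχ (s := s) (by linarith)
  have ht : Tendsto (fun F : Finset Nat.Primes =>
      ∏ p ∈ F, starFactor (χ ((p : ℕ) : ZMod D)) (((p : ℕ) : ℂ) ^ (-s))) atTop
      (𝓝 (phiStar χ s)) := by
    simpa [HasProd] using hP
  refine le_of_tendsto' ht.norm fun F => ?_
  have h1 : ∀ p ∈ F, ‖starFactor (χ ((p : ℕ) : ZMod D)) (((p : ℕ) : ℂ) ^ (-s))‖ ≤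
      Real.exp (7659 * ((p : ℕ) : ℝ) ^ (-(2 * σ₀))) := by
    intro p _
    have hsq := norm_cpow_sq_le hs p
    have hx0 : 0 ≤ ((p : ℕ) : ℝ) ^ (-(2 * σ₀)) := by positivity
    rcases apply_eq_zero_or_one_or_neg_one χ hχ ((p : ℕ) : ZMod D) with h0 | hw
    · rw [h0]
      have hpD : (p : ℕ) ∣ D := (apply_prime_eq_zero_iff χ p.prop).1 h0
      have hb := norm_starFactor_zero_le_of_re_nonneg (hre p p.prop hpD)
      have h3 : (1 + ‖((p : ℕ) : ℂ) ^ (-s)‖ ^ 2) ^ 3 ≤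
          Real.exp (7659 * ((p : ℕ) : ℝ) ^ (-(2 * σ₀))) := by
        have hle : 1 + ‖((p : ℕ) : ℂ) ^ (-s)‖ ^ 2 ≤ Real.exp (((p : ℕ) : ℝ) ^ (-(2 * σ₀))) := by
          linarith [Real.add_one_le_exp (((p : ℕ) : ℝ) ^ (-(2 * σ₀)))]
        calc (1 + ‖((p : ℕ) : ℂ) ^ (-s)‖ ^ 2) ^ 3 ≤ (Real.exp (((p : ℕ) : ℝ) ^ (-(2 * σ₀)))) ^ 3 :=
              pow_le_pow_left₀ (by positivity) hle 3
          _ = Real.exp (3 * ((p : ℕ) : ℝ) ^ (-(2 * σ₀))) := by rw [← Real.exp_nat_mul]; norm_num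
          _ ≤ Real.exp (7659 * ((p : ℕ) : ℝ) ^ (-(2 * σ₀))) := by
              rw [Real.exp_le_exp]; nlinarith
      exact hb.trans h3
    · exact norm_starFactor_le_exp_of_unit hσ₀ hs p hw
  rw [norm_prod]
  calc ∏ p ∈ F, ‖starFactor (χ ((p : ℕ) : ZMod D)) (((p : ℕ) : ℂ) ^ (-s))‖
      ≤ ∏ p ∈ F, Real.exp (7659 * ((p : ℕ) : ℝ) ^ (-(2 * σ₀))) :=
        Finset.prod_le_prod (fun _ _ => norm_nonneg _) h1
    _ = Real.exp (∑ p ∈ F, 7659 * ((p : ℕ) : ℝ) ^ (-(2 * σ₀))) := by rw [Real.exp_sum]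
    _ ≤ Real.exp (7659 * ∑' p : Nat.Primes, ((p : ℕ) : ℝ) ^ (-(2 * σ₀))) := by
        rw [Real.exp_le_exp, ← Finset.mul_sum]
        gcongr
        exact hsumm.sum_le_tsum F fun p _ => by positivity

end Bounds

end Literature.NumberTheory.LFunctions.Zhang2022.PhiStar

end
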